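import Literature.MathematicalPhysics.QuantumFieldTheory.Balaban1983to89.B7
import Literature.Analysis.Complex.RungeUnits

/-!
# `Balaban1983to89.B7Eq214` — T. Bałaban, *Averaging operations for lattice gauge theories*, Commun. Math. Phys.
# **98**, 17–51 (1985), THE CLOSING DISPLAYS (207)–(214), p. 50: the averaged gauge transformations `ũ′ʲ` as
# functions of `λ = (1/i) log u′`, the functions `Q′_j(u₁, λ) = (1/i) log ũ′ʲ` (208), and the REPRESENTATION
# `Q′_j(u₁, λ, y) = (Q′_jλ)(y) + C′_j(u₁, λ, y)`, `|C′_j(u₁, λ, y)| = O((α₃α₄ + α₄²)Lʲη)` (213)–(214) — typed at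
# statement level, with the level bookkeeping (212) ⇒ (214) and the sentence "(176), (177) … with a constant `4α₄`"
# kernel-checked (`B7Eq214`)

statement-level skeleton of published theorems with citation tags; proofs where landed; nothing here is a claim about the Yang–Mills mass gap

CITATION HEADER (lean-in-tree rule 2026-08-18).  Source: T. Bałaban, "Averaging operations for lattice gauge theories",
*Comm. Math. Phys.* **98**, 17–51 (1985) [Balaban1985Averaging] (paper B7 of the tree directory `Balaban1983to89/`; held
text `paper:balaban1985-cmp98-averaging`, journal page = PDF page + 16), Sect. F, p. 50 [PDF 34], read AS AN IMAGE from the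
render `run/shared/lean/pub/pub-balaban/b2b-balaban-ref1/pages/1985-cmp98-averaging/1985-cmp98-averaging-p034-x2.png`
by the filing unit (lit-balaban reader/typer r04, 2026-08-20), together with p. 43 (render p027: (165), `∂_{U₀}`), p. 28
(OCR p0012: `(D_{V₀}λ)(b) = R_{0,b}λ(b₊) − λ(b₋)`), p. 45 (render p029: (176)–(179)) and p. 49 (render p033: (199)–(206)).
The paper is UNDER ADJUDICATION by the audit cell `pub-balaban`; NOTHING printed in it is asserted here: the two
`…Printed` definitions below are `Prop`s consumed downstream only as hypotheses `(h : …Printed fam)`, exactly like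
`B7.Prop1Printed` … `B7.Prop10Printed` of the module `…Balaban1983to89.B7`, which this module imports and extends
(the carrier `GaugeLinData` EXTENDS `B7.GaugeData`; no declaration of `B7` is restated or modified).  Why a module at
all: at 2026-08-20T22:10Z no declaration of the tree carried a locator (207)–(214) (cell file
`run/shared/lean/pub/lit-balaban/EXISTING-DECLS.tsv`), while the NEXT paper of the series consumes exactly these
displays — B8 = T. Bałaban, *Spaces of regular gauge field configurations on a lattice and gauge fixing conditions*,
Comm. Math. Phys. **99**, 75–102 (1985) [Balaban1985RegularSpaces], Sect. D p. 89 [PDF 15]: *"… thus for α₀ + α₁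
sufficiently small the assumptions of Proposition 10 are satisfied and we have the representation (213) and the bounds
(214) [3]."* ([3] = B7; quoted in the tree's `…Balaban1983to89.B8`, § (iii-d)).  So (213)–(214) is an INTERFACE row of
the statement skeleton (lit-balaban SKELETON rows B7-D207, B7-D213, B7-E209, B7-E213).

WHAT IS PRINTED (p. 50, verbatim; `‾` = the paper's overbar, `R̄` = `R` under a bar, `𝔤ᶜ` = the complexified Lie
algebra of (16)).  After Proposition 10: *"This result implies in particular that the configuration u′ belongs to the
class Λ_k(C₅α₄). The assumptions (176), (177) can be reformulated in terms of the functions λ = (1/i) log u′. If we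
assume
  |(D^η_{U₀}λ)(b)| < α₄,  |λ(x)| < α₄,  λ(x) ∈ 𝔤ᶜ,  α₄ sufficiently small, (207)
then assumptions (176), (177) are satisfied with a constant 4α₄ instead of α₄. It is obvious from the definition of
the averaging operations that ũ′ʲ are analytic functions of λ, and
  Q′_j(u₁, λ) = (1/i) log ũ′ʲ,  j ≦ k, (208)
are analytic functions of λ also. We want to calculate a linear term in an expansion of this function. In fact, we
will be satisfied with a good approximation of this term. From (184), (187), we have for v′ = e^{iλ}
  ṽ′(y) = exp[iλ(y) + i Σ_{x∈B(y)} L^{−d}(R_{0,y}A)(Γ_{y,x}) + O(α₄Lα′₄) + O(L²(α′₃ + α′₄)α′₄)]. (209)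
By definition of A,
  A_b = (1/i) log e^{−iλ(b₋)}e^{iR_{0,b}λ(b₊)} = (1/i) log e^{−iλ(b₋)}e^{iλ(b₋)+i(D_{V₀}λ)(b)} = (D_{V₀}λ)(b) + O(α₄α′₄ + α′₄²), (210)
hence
  (1/i) log ṽ′(y) = Σ_{x∈B(y)} L^{−d}(R_{0,y}λ)(x) + O(α₄Lα′₄ + L²α′₃α′₄ + L²α′₄²). (211)
By (179) the function Q′_j(u₁, λ) is a composition of one-step functions and from the above formula we can easily
see that
  Q′_j(u₁, λ, y) = Σ_{x∈Bʲ(y)} L^{−jd}R(U₀(Γ^{(j)}_{y,x}))λ(x) + Σ_{l=0}^{j−1} O(C₅α₄2α₄L^lη + α₃2α₄(L^lη)² + 4α₄²(L^lη)²), (212)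
hence
  Q′_j(u₁, λ, y) = (Q′_jλ)(y) + C′_j(u₁, λ, y), (213)
  |C′_j(u₁, λ, y)| = O((α₃α₄ + α₄²)Lʲη). (214)"*  (End of the paper's text; p. 51 = references.)
Context (verbatim).  p. 45 [PDF 29]: *"|u′(x) − 1| < α₄, x ∈ Ω, (176)  |u′^{−1}(b₋)R_{0,b}u′(b₊) − 1| < α₄η, b ⊂ Ω.
(177) … we will consider configurations u′ with values in the complexified group Gᶜ, i.e., u′ = e^{iλ} and λ has
values in the complexified algebra 𝔤ᶜ. We will consider the averages ũ′ʲ = (R̄₀u′u₁)ʲ‾ ((R̄₀u₁)ʲ‾)^{−1}. (178)"*;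
p. 50: *"Proposition 10. There exist positive constants C₄, C₅, c₆ such that for arbitrary configurations U₀, u′, u₁
satisfying (52), (176), (177), (166), (167) with α₀, α₃, α₄ ≦ c₆ the bounds (203), (204) hold for j ≦ k."*;
p. 27 (display after (59)) / (56): `(R_{0,b}v)(b₊) = R(V_{0,b})v(b₊)`, `R(X)Y = XYX^{−1}`; p. 28: *"A_b − (R_{0,b}λ(b₊)
− λ(b₋)) = A_b − (D_{V₀}λ)(b)"*; p. 43 (165): *"|(∂_{U₀}u)(b)| = |R(U_{0,b})u(b₊) − u(b₋)| < α₀η, b ⊂ Ω."*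

READINGS (recorded, none is an objection to print).  (R1) `D^η_{U₀}` in (207) is the η-lattice covariant derivative
`(D^η_{U₀}λ)(b) = η^{−1}[R(U_{0,b})λ(b₊) − λ(b₋)]` (p. 28's `D_{V₀}` on the unit lattice, rescaled as (165)/(177) are:
`|(D^η_{U₀}λ)(b)| < α₄ ⇔ |R(U_{0,b})λ(b₊) − λ(b₋)| < α₄η`); the kernel certificate `ineq177_of_207` below is stated
directly with the bound `‖R(U_{0,b})(iλ(b₊)) − iλ(b₋)‖ < α₄η`, so no convention on `D^η` enters it.  (R2) The
`O(·)` of (212)/(214) is not given a name or a dependence in print; it is typed like the constants of Proposition 10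
(`B7.Prop10Printed`): chosen BEFORE the instance `i` of a family with FIXED `d`, `L` (the instance carries `k`, `η`,
the lattice and the background), i.e. uniform in `k`, `j`, `η`, `U₀`, `u₁`, `λ` and allowed to depend on `d`, `L`
— print derives it from `C₄, C₅` (Prop. 10), the one-step `O`'s of (209)–(211) (= those of (181)–(198), Prop. 9)
and the geometric sums of (212) (`ineq214_of_212` below: a factor ≤ `2C₅ + 6`).  (R3) "α₄ sufficiently small"
(207) and Prop. 10's "α₀, α₃, α₄ ≦ c₆" are merged into one threshold `c₇` chosen with the constant.  (R4) The
hypotheses under which (208)–(214) are printed are those of the running paragraph: `U₀` with (52), `u₁` with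
(166)–(167) (`u₁ ∈ Λ_k(U₀, α₃)`), `u′ = e^{iλ}` with (207).  (R5) `B7.GaugeData.Reg176 : ℝ → GT → Prop` (the
tree's carrier field for (176)–(177)) carries no background argument although (177) involves `R_{0,b} = R(U_{0,b})`;
this module inherits that field unchanged (`Eq207Printed` concludes `Reg176 (4α₄) (e^{iλ})` for the instance's
background) — an abstraction note for the referee (F6), not a statement about print.  (R6) The linear operator
`(Q′_jλ)(y) = Σ_{x∈Bʲ(y)} L^{−jd}R(U₀(Γ^{(j)}_{y,x}))λ(x)` of (212)–(213) EXISTS in the tree as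
`B7Eq78Linearization.QprimeIter` (typed from B9 (3.19), and PROVED there to be the derivative at `u = 1` of
`(1/i) log (R̄₀uʲ)` — the `u₁ = 1` case of the linear term of (208)); it is not re-declared here: the abstract carrier
only names the supremum of the remainder `C′_j = Q′_j(u₁, λ, ·) − Q′_jλ`.

WHAT IS TYPED / PROVED HERE (0 `sorry`; new named facts: the two `…Printed` `Prop`s, statement level, as the rest of
the B7 skeleton; everything else is a kernel theorem).
* `GaugeLinData` — the carrier: `B7.GaugeData` (backgrounds `U₀` with (52)-deviation, gauge transformations, `k`, `η`,
  `L`, the class predicate `InLambda` = (166)–(167), `Reg176` = (176)–(177), the Prop.-10 suprema) EXTENDED by the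
  𝔤ᶜ-valued site functions `λ` (`Alg`), `expI λ = e^{iλ}`, `lamSup λ = sup_x |λ(x)|`, `covDerivSup U₀ λ =
  sup_b |(D^η_{U₀}λ)(b)|`, the analyticity predicate of (208) and `remDev U₀ u₁ λ j = sup_{y∈Ω^{(j)}} |C′_j(u₁, λ, y)|`.
* `Eq207Printed` — the sentence "(207) ⇒ (176), (177) with `4α₄`", statement level; AND its kernel certificate in any
  complete normed ℂ-algebra with `‖1‖ = 1` (matrices with the operator norm (19)): `ineq176_of_207`
  (`‖e^{a} − 1‖ < 4α₄` for `‖a‖ < α₄ ≤ 1/4`, indeed `≤ e^{1/4}α₄`) and `ineq177_of_207` (`‖e^{−a₋}·R(U)(e^{a₊}) − 1‖ < 4α₄η`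
  for `‖a₋‖ < α₄ ≤ 1/4`, `‖R(U)a₊ − a₋‖ < α₄η`, `η ≤ 1`; indeed `≤ e^{3/4}·α₄η`), `a = iλ`.
* `Eq214Printed` — (208) + (213)–(214) under (R2)–(R4), statement level.
* `sum_pow_mul_le`, `sum_level_terms_le`, `ineq214_of_212` — the bookkeeping (212) ⇒ (214): for `L ≥ 2`, `η ≥ 0`,
  `Lʲη ≤ 1`, `Σ_{l<j} [C₅α₄·2α₄·Lˡη + α₃·2α₄·(Lˡη)² + 4α₄²(Lˡη)²] ≤ (2C₅ + 6)(α₃α₄ + α₄²)·Lʲη`.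
VALUE = typed interface row + checked arithmetic, NOT summit progress.  Unit `lit-balaban-r04` (reader/typer, CMP 98).
-/

namespace Literature.MathematicalPhysics.QuantumFieldTheory.Balaban1983to89.B7Eq214

open Finset NormedSpace

/-! ## The carrier and the two printed statements (statement level) -/

/-- Abstract carrier of the closing paragraph of Sect. F (p. 50 [PDF 34]): the data of `B7.GaugeData` — backgrounds
`U₀ : Cfg` on `Ω ⊂ ηℤᵈ` with `plaqDevEta U₀ = sup_p |U₀(∂p) − 1|·η⁻²` ((52)), gauge transformations `GT`, the levels
`k`, `eta = η = L^{−k}`, `L`, `InLambda U₀ α₃ u = "u ∈ Λ_k(U₀, α₃)"` ((166)–(167)), `Reg176 α u′` = (176)–(177) with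
constant `α` (relative to the instance's background, READING (R5)), the suprema `avgDev203/204` of Prop. 10 —
EXTENDED by: `Alg` = the 𝔤ᶜ-valued site functions `λ` on `Ω`; `expI λ` = the 𝐆ᶜ-valued configuration `u′ = e^{iλ}`
(p. 45); `lamSup λ = sup_{x∈Ω} |λ(x)|` and `covDerivSup U₀ λ = sup_{b⊂Ω} |(D^η_{U₀}λ)(b)|` (the two quantities of
(207), READING (R1)); `IsAnalyticQp U₀ u₁ j α₄` = *"Q′_j(u₁, λ) = (1/i) log ũ′ʲ … are analytic functions of λ"* (208)
on the domain (207) of size `α₄`, where `ũ′ʲ = (R̄₀u′u₁)ʲ‾((R̄₀u₁)ʲ‾)⁻¹` (178) with `u′ = e^{iλ}`; and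
`remDev U₀ u₁ λ j = sup_{y∈Ω^{(j)}} |C′_j(u₁, λ, y)|`, `C′_j(u₁, λ, y) = Q′_j(u₁, λ, y) − (Q′_jλ)(y)` (213), with
`(Q′_jλ)(y) = Σ_{x∈Bʲ(y)} L^{−jd}R(U₀(Γ^{(j)}_{y,x}))λ(x)` (212) (the tree's `B7Eq78Linearization.QprimeIter`, READING
(R6)).  ⟨F6: the objects `ũ′ʲ`, `Q′_j(u₁, λ)`, `Q′_j`, `C′_j` live inside these fields; only their printed bounds are
typed.⟩ [cite: Balaban1985Averaging, (207)–(208) + (213) p.50] -/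
structure GaugeLinData extends B7.GaugeData where
  /-- 𝔤ᶜ-valued site functions `λ` on `Ω` (p. 50, (207): "λ(x) ∈ 𝔤ᶜ"). -/
  Alg : Type
  /-- `λ ↦ u′ = e^{iλ}` (p. 45: "u′ = e^{iλ} and λ has values in the complexified algebra 𝔤ᶜ"). -/
  expI : Alg → GT
  /-- `sup_{x∈Ω} |λ(x)|` ((207), second condition). -/
  lamSup : Alg → ℝ
  /-- `sup_{b⊂Ω} |(D^η_{U₀}λ)(b)|` ((207), first condition; READING (R1)). -/
  covDerivSup : Cfg → Alg → ℝ
  /-- (208): "`Q′_j(u₁, λ) = (1/i) log ũ′ʲ, j ≦ k`, are analytic functions of λ" on the domain (207) of size `α₄`. -/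
  IsAnalyticQp : Cfg → GT → ℕ → ℝ → Prop
  /-- `sup_{y∈Ω^{(j)}} |C′_j(u₁, λ, y)|`, `C′_j(u₁, λ, y) = Q′_j(u₁, λ, y) − (Q′_jλ)(y)` ((213)). -/
  remDev : Cfg → GT → Alg → ℕ → ℝ

/-- **(207) ⇒ (176)–(177) with `4α₄`** (p. 50 [PDF 34], verbatim): *"The assumptions (176), (177) can be reformulated
in terms of the functions λ = (1/i) log u′. If we assume |(D^η_{U₀}λ)(b)| < α₄, |λ(x)| < α₄, λ(x) ∈ 𝔤ᶜ, α₄ sufficiently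
small, (207) then assumptions (176), (177) are satisfied with a constant 4α₄ instead of α₄."*  "α₄ sufficiently small"
= a threshold `c₇ > 0` chosen before the instance (READING (R3)); the conclusion is the carrier's (176)–(177) predicate
with constant `4α₄` for `u′ = e^{iλ}` (READING (R5)).  Kernel certificate of the sentence for matrices:
`ineq176_of_207`, `ineq177_of_207` below (`c₇ = 1/4` suffices, with `η ≤ 1`). [cite: Balaban1985Averaging, (207) p.50] -/
def Eq207Printed {I : Type} (fam : I → GaugeLinData) : Prop :=
  ∃ c₇ : ℝ, 0 < c₇ ∧
    ∀ i : I, ∀ α₄ : ℝ, 0 < α₄ → α₄ ≤ c₇ → ∀ U₀ : (fam i).Cfg, ∀ lam : (fam i).Alg,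
      (fam i).covDerivSup U₀ lam < α₄ → (fam i).lamSup lam < α₄ →
        (fam i).Reg176 (4 * α₄) ((fam i).expI lam)

/-- **(208), (213)–(214)** (p. 50 [PDF 34], verbatim): *"It is obvious from the definition of the averaging operations
that ũ′ʲ are analytic functions of λ, and Q′_j(u₁, λ) = (1/i) log ũ′ʲ, j ≦ k, (208) are analytic functions of λ also.
… hence Q′_j(u₁, λ, y) = (Q′_jλ)(y) + C′_j(u₁, λ, y), (213)  |C′_j(u₁, λ, y)| = O((α₃α₄ + α₄²)Lʲη). (214)"* — under
the running hypotheses (READING (R4)): `U₀` satisfies (52) with `α₀`, `u₁ ∈ Λ_k(U₀, α₃)` ((166)–(167)), `u′ = e^{iλ}`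
with `λ` satisfying (207) with `α₄`, and `α₀, α₃, α₄` sufficiently small (Prop. 10's `c₆` and (207)'s "α₄ sufficiently
small", merged: READING (R3)).  The `O(·)`-constant `O₂` and the threshold `c₇` are chosen BEFORE the instance `i`
(fixed `d`, `L`; uniform in `k`, `j ≤ k`, `η`, the lattice, `U₀`, `u₁`, `λ` — READING (R2)).  Family index `I` as in
`B7.Prop10Printed` (DIVERGENCE D-pv14.2 convention: `(fam i).L = L` for one `L`; nothing `L`-uniform is asserted).
Consumed by [Balaban1985RegularSpaces] Sect. D p. 89 ("we have the representation (213) and the bounds (214) [3]").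
[cite: Balaban1985Averaging, (208) + (213)–(214) p.50] -/
def Eq214Printed {I : Type} (fam : I → GaugeLinData) : Prop :=
  ∃ O₂ c₇ : ℝ, 0 < O₂ ∧ 0 < c₇ ∧
    ∀ i : I, ∀ α₀ α₃ α₄ : ℝ, 0 < α₀ → α₀ ≤ c₇ → 0 < α₃ → α₃ ≤ c₇ → 0 < α₄ → α₄ ≤ c₇ →
      ∀ U₀ : (fam i).Cfg, ∀ u₁ : (fam i).GT,
        (fam i).plaqDevEta U₀ < α₀ → (fam i).InLambda U₀ α₃ u₁ →
          (∀ j : ℕ, j ≤ (fam i).k → (fam i).IsAnalyticQp U₀ u₁ j α₄) ∧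
          ∀ lam : (fam i).Alg, (fam i).covDerivSup U₀ lam < α₄ → (fam i).lamSup lam < α₄ →
            ∀ j : ℕ, j ≤ (fam i).k →
              (fam i).remDev U₀ u₁ lam j ≤ O₂ * (α₃ * α₄ + α₄ ^ 2) * ((fam i).L ^ j * (fam i).eta)

/-! ## (212) ⇒ (214): the level bookkeeping, kernel-checked -/

/-- Geometric bookkeeping behind (212) ⇒ (214): for `L ≥ 2`, `η ≥ 0` and every `j`, `Σ_{l<j} Lˡη ≤ Lʲη`
(`Σ_{l<j} Lˡ = (Lʲ − 1)/(L − 1) ≤ Lʲ`). [cite: Balaban1985Averaging, (212)–(214) p.50] -/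
theorem sum_pow_mul_le (L η : ℝ) (hL : 2 ≤ L) (hη : 0 ≤ η) :
    ∀ j : ℕ, ∑ l ∈ range j, L ^ l * η ≤ L ^ j * η := by
  intro j
  induction j with
  | zero => simp; positivity
  | succ j ih =>
      rw [sum_range_succ, pow_succ]
      have hLj : 0 ≤ L ^ j := pow_nonneg (by linarith) j
      nlinarith [mul_nonneg hLj hη]

/-- The level terms of (212) are dominated level by level: for `L ≥ 1`, `η ≥ 0`, `Lʲη ≤ 1`, `l < j` and `a, b ≥ 0`,
`a·Lˡη + b·(Lˡη)² ≤ (a + b)·Lˡη` (since `Lˡη ≤ Lʲη ≤ 1`), hence `Σ_{l<j} [a·Lˡη + b·(Lˡη)²] ≤ (a + b)·Lʲη` for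
`L ≥ 2`. [cite: Balaban1985Averaging, (212)–(214) p.50] -/
theorem sum_level_terms_le (L η a b : ℝ) (j : ℕ) (hL : 2 ≤ L) (hη : 0 ≤ η) (hj : L ^ j * η ≤ 1)
    (ha : 0 ≤ a) (hb : 0 ≤ b) :
    ∑ l ∈ range j, (a * (L ^ l * η) + b * (L ^ l * η) ^ 2) ≤ (a + b) * (L ^ j * η) := by
  have hterm : ∀ l ∈ range j, a * (L ^ l * η) + b * (L ^ l * η) ^ 2 ≤ (a + b) * (L ^ l * η) := by
    intro l hl
    have hlj : l ≤ j := (mem_range.mp hl).le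
    have hx0 : 0 ≤ L ^ l * η := mul_nonneg (pow_nonneg (by linarith) l) hη
    have hx1 : L ^ l * η ≤ 1 :=
      le_trans (mul_le_mul_of_nonneg_right (pow_le_pow_right₀ (by linarith) hlj) hη) hj
    have hsq : (L ^ l * η) ^ 2 ≤ L ^ l * η := by nlinarith
    nlinarith [mul_le_mul_of_nonneg_left hsq hb]
  calc ∑ l ∈ range j, (a * (L ^ l * η) + b * (L ^ l * η) ^ 2)
      ≤ ∑ l ∈ range j, (a + b) * (L ^ l * η) := sum_le_sum hterm
    _ = (a + b) * ∑ l ∈ range j, L ^ l * η := by rw [mul_sum]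
    _ ≤ (a + b) * (L ^ j * η) :=
        mul_le_mul_of_nonneg_left (sum_pow_mul_le L η hL hη j) (by positivity)

/-- **(212) ⇒ (214), kernel-checked** (p. 50 [PDF 34]): the remainder sum of (212),
`Σ_{l=0}^{j−1} [C₅α₄·2α₄·Lˡη + α₃·2α₄·(Lˡη)² + 4α₄²·(Lˡη)²]`, is `≤ (2C₅ + 6)(α₃α₄ + α₄²)·Lʲη` for `L ≥ 2`, `η ≥ 0`,
`Lʲη ≤ 1` (levels below the unit scale, `η = L^{−k}`, `j ≤ k`), `α₃, α₄, C₅ ≥ 0` — i.e. (214)'s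
`O((α₃α₄ + α₄²)Lʲη)` with the `O` explicit in terms of the per-level `O(1)`'s (here normalised to `1`; a common
per-level factor `K` multiplies through).  The per-level `O`-terms themselves ((209)–(211)) are Prop. 9's one-step
analysis and are NOT proved here. [cite: Balaban1985Averaging, (212)–(214) p.50] -/
theorem ineq214_of_212 (L η α₃ α₄ C₅ : ℝ) (j : ℕ) (hL : 2 ≤ L) (hη : 0 ≤ η) (hj : L ^ j * η ≤ 1)
    (hα₃ : 0 ≤ α₃) (hα₄ : 0 ≤ α₄) (hC₅ : 0 ≤ C₅) :
    ∑ l ∈ range j,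
        (C₅ * α₄ * (2 * α₄) * (L ^ l * η) + α₃ * (2 * α₄) * (L ^ l * η) ^ 2 + 4 * α₄ ^ 2 * (L ^ l * η) ^ 2)
      ≤ (2 * C₅ + 6) * (α₃ * α₄ + α₄ ^ 2) * (L ^ j * η) := by
  have h := sum_level_terms_le L η (C₅ * α₄ * (2 * α₄)) (α₃ * (2 * α₄) + 4 * α₄ ^ 2) j hL hη hj
    (by positivity) (by positivity)
  have hre : ∀ l : ℕ, C₅ * α₄ * (2 * α₄) * (L ^ l * η) + α₃ * (2 * α₄) * (L ^ l * η) ^ 2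
      + 4 * α₄ ^ 2 * (L ^ l * η) ^ 2
      = C₅ * α₄ * (2 * α₄) * (L ^ l * η) + (α₃ * (2 * α₄) + 4 * α₄ ^ 2) * (L ^ l * η) ^ 2 := by
    intro l; ring
  simp_rw [hre]
  refine h.trans ?_
  have hx0 : 0 ≤ L ^ j * η := mul_nonneg (pow_nonneg (by linarith) j) hη
  have hcoef : C₅ * α₄ * (2 * α₄) + (α₃ * (2 * α₄) + 4 * α₄ ^ 2) ≤ (2 * C₅ + 6) * (α₃ * α₄ + α₄ ^ 2) := by
    nlinarith [mul_nonneg hC₅ (mul_nonneg hα₃ hα₄), mul_nonneg hα₃ hα₄, sq_nonneg α₄,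
      mul_nonneg hC₅ (sq_nonneg α₄)]
  exact mul_le_mul_of_nonneg_right hcoef hx0

/-! ## "(176), (177) are satisfied with a constant `4α₄`": the kernel certificate

Values in a complete normed ℂ-algebra `𝔸` with `‖1‖ = 1` (the paper's `M_N(ℂ)` with the operator norm (19)); the
Lie-algebra variables enter as the elements `a = iλ(x) ∈ 𝔸` (`‖a‖ = |λ(x)|`), `u′(x) = e^{a}` (`NormedSpace.exp`),
`u′(x)⁻¹ = e^{−a}`, and `R(U)Y = UYU⁻¹` ((56)) for a unit `U = U_{0,b} ∈ 𝔸ˣ`, so that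
`R_{0,b}u′(b₊) = R(U_{0,b})e^{iλ(b₊)} = e^{R(U_{0,b})(iλ(b₊))}` and `R(U_{0,b})(iλ(b₊)) = iλ(b₋) + iη(D^η_{U₀}λ)(b)`
(READING (R1)). -/

section Certificate

variable {𝔸 : Type*} [NormedRing 𝔸] [NormedAlgebra ℂ 𝔸] [CompleteSpace 𝔸] [NormOneClass 𝔸]

/-- `e^{3/4} < 4` (indeed `e^{3/4} ≤ e < 2.72`). [cite: Balaban1985Averaging, (207) p.50] -/
theorem exp_three_quarters_lt_four : Real.exp (3 / 4) < 4 :=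
  lt_trans (Real.exp_lt_exp.mpr (by norm_num)) (lt_trans Real.exp_one_lt_d9 (by norm_num))

/-- **(207) ⇒ (176) with `4α₄`**: `‖e^{a} − 1‖ < 4α₄` whenever `‖a‖ < α₄ ≤ 1/4` (`a = iλ(x)`, `|λ(x)| < α₄`);
in fact `‖e^{a} − 1‖ ≤ ‖a‖e^{‖a‖} ≤ e^{1/4}‖a‖`. [cite: Balaban1985Averaging, (207) + (176) pp.45–50] -/
theorem ineq176_of_207 (a : 𝔸) {α₄ : ℝ} (hα₄ : α₄ ≤ 1 / 4) (ha : ‖a‖ < α₄) :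
    ‖exp a - 1‖ < 4 * α₄ := by
  have h := Literature.Analysis.Complex.norm_exp_sub_exp_le a 0
  rw [exp_zero, sub_zero, norm_zero, max_eq_left (norm_nonneg a)] at h
  have hexp : Real.exp ‖a‖ ≤ Real.exp (3 / 4) := Real.exp_le_exp.mpr (by linarith [norm_nonneg a])
  have h4 : Real.exp ‖a‖ < 4 := lt_of_le_of_lt hexp exp_three_quarters_lt_four
  calc ‖exp a - 1‖ ≤ ‖a‖ * Real.exp ‖a‖ := h
    _ ≤ ‖a‖ * 4 := mul_le_mul_of_nonneg_left h4.le (norm_nonneg a)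
    _ < α₄ * 4 := by nlinarith [norm_nonneg a]
    _ = 4 * α₄ := by ring

omit [NormOneClass 𝔸] in
/-- (41)/(56) p. 23/27: conjugation commutes with the exponential, `R(U)e^{Y} = e^{R(U)Y}`, i.e.
`R_{0,b}u′(b₊) = e^{R(U_{0,b})(iλ(b₊))}` for `u′ = e^{iλ}`. [cite: Balaban1985Averaging, (41) p.23 + (56) p.27] -/
theorem conj_exp_eq (U : 𝔸ˣ) (Y : 𝔸) : (U : 𝔸) * exp Y * ↑U⁻¹ = exp ((U : 𝔸) * Y * ↑U⁻¹) := by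
  letI : NormedAlgebra ℚ 𝔸 := NormedAlgebra.restrictScalars ℚ ℂ 𝔸
  exact (exp_units_conj U Y).symm

/-- **(207) ⇒ (177) with `4α₄`**: with `am = iλ(b₋)`, `ap = iλ(b₊)`, `U = U_{0,b}`: if `‖am‖ < α₄ ≤ 1/4` ((207), second
condition) and `‖R(U)ap − am‖ < α₄η` ((207), first condition: `R(U_{0,b})λ(b₊) − λ(b₋) = η(D^η_{U₀}λ)(b)`, READING (R1))
with `η ≤ 1`, then `‖u′(b₋)⁻¹R_{0,b}u′(b₊) − 1‖ = ‖e^{−am}·R(U)e^{ap} − 1‖ < 4α₄η`; in fact `≤ e^{3/4}·‖R(U)ap − am‖`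
(`e^{−am}R(U)e^{ap} − 1 = e^{−am}(e^{am + Y} − e^{am})`, `Y = R(U)ap − am`, and `‖e^{X+Y} − e^{X}‖ ≤ ‖Y‖e^{max(‖X+Y‖,‖X‖)}`).
[cite: Balaban1985Averaging, (207) + (177) pp.45–50] -/
theorem ineq177_of_207 (U : 𝔸ˣ) (am ap : 𝔸) {α₄ η : ℝ} (hα₄ : α₄ ≤ 1 / 4) (hη : η ≤ 1)
    (ha : ‖am‖ < α₄) (hD : ‖(U : 𝔸) * ap * ↑U⁻¹ - am‖ < α₄ * η) :
    ‖exp (-am) * ((U : 𝔸) * exp ap * ↑U⁻¹) - 1‖ < 4 * α₄ * η := by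
  set Y : 𝔸 := (U : 𝔸) * ap * ↑U⁻¹ - am with hYdef
  have hα₄0 : 0 < α₄ := lt_of_le_of_lt (norm_nonneg _) ha
  have hY0 : 0 ≤ ‖Y‖ := norm_nonneg _
  have hYlt : ‖Y‖ < α₄ * η := hD
  have hYle : ‖Y‖ ≤ 1 / 4 := by
    have : α₄ * η ≤ α₄ * 1 := mul_le_mul_of_nonneg_left hη hα₄0.le
    linarith
  have hconj : (U : 𝔸) * ap * ↑U⁻¹ = am + Y := by rw [hYdef]; abel
  have hinv : exp (-am) * exp am = 1 := by
    -- `e^{−a}e^{a} = 1` (the tree's `Literature.Analysis.Calculus.exp_neg_mul_exp`, restated inline over `ℂ`)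
    letI : NormedAlgebra ℚ 𝔸 := NormedAlgebra.restrictScalars ℚ ℂ 𝔸
    rw [← exp_add_of_commute (Commute.refl am).neg_left, neg_add_cancel, exp_zero]
  have hid : exp (-am) * ((U : 𝔸) * exp ap * ↑U⁻¹) - 1 = exp (-am) * (exp (am + Y) - exp am) := by
    rw [conj_exp_eq, hconj, mul_sub, hinv]
  rw [hid]
  have hlip := Literature.Analysis.Complex.norm_exp_sub_exp_le (am + Y) am
  rw [add_sub_cancel_left] at hlip
  have hmax : max ‖am + Y‖ ‖am‖ ≤ 1 / 2 := by
    refine max_le ?_ (by linarith)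
    exact (norm_add_le _ _).trans (by linarith)
  have hexpmax : Real.exp (max ‖am + Y‖ ‖am‖) ≤ Real.exp (1 / 2) := Real.exp_le_exp.mpr hmax
  have hneg : ‖exp (-am)‖ ≤ Real.exp (1 / 4) := by
    refine (Literature.Analysis.Complex.norm_exp_le_exp_norm (-am)).trans ?_
    rw [norm_neg]; exact Real.exp_le_exp.mpr (by linarith)
  have hprod : Real.exp (1 / 4) * Real.exp (1 / 2) = Real.exp (3 / 4) := by
    rw [← Real.exp_add]; norm_num
  calc ‖exp (-am) * (exp (am + Y) - exp am)‖
      ≤ ‖exp (-am)‖ * ‖exp (am + Y) - exp am‖ := norm_mul_le _ _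
    _ ≤ Real.exp (1 / 4) * (‖Y‖ * Real.exp (1 / 2)) := by
        refine mul_le_mul hneg (hlip.trans ?_) (norm_nonneg _) (Real.exp_pos _).le
        exact mul_le_mul_of_nonneg_left hexpmax hY0
    _ = ‖Y‖ * Real.exp (3 / 4) := by rw [← hprod]; ring
    _ ≤ ‖Y‖ * 4 := mul_le_mul_of_nonneg_left exp_three_quarters_lt_four.le hY0
    _ < α₄ * η * 4 := by nlinarith
    _ = 4 * α₄ * η := by ring

end Certificate

end Literature.MathematicalPhysics.QuantumFieldTheory.Balaban1983to89.B7Eq214
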